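import Literature.NumberTheory.Irrationality.LaiLupuSprang2025.PhiFactor
import Literature.NumberTheory.Irrationality.Hata1992.PeriodicStepFactor
import Literature.NumberTheory.Irrationality.PAdicZetaValues.Records
import HarnessLib

/-!
# Lai–Lupu–Sprang 2025, §7 (second half): the rate `Φ_n = e^{(ϖ_p + o(1))n}` (Lemma 7.3), Gauss's digamma sum
# `Σ_{j=1}^{p} ψ(j/p) = −p(γ + log p)`, and the estimate `ϖ_p < p − 1` (the half of Lemma 7.4 that is used) — PROVED

Topic `Literature/NumberTheory/Irrationality/LaiLupuSprang2025`.  Source: L. Lai, C. Lupu, J. Sprang, *On the irrationality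
of certain `p`-adic zeta values*, Res. Math. Sci. 12 (2025) = arXiv:2505.23088 [LaiLupuSprang2025], §7 "Archimedean
properties", Lemma 7.2 (the window lemma, «a corollary of the prime number theorem (cf. [Zud2002])»), Lemma 7.3 and
Lemma 7.4 (held text `paper:arxiv-2505.23088`, chunk p0011, read on the page).  PROOF FILE (one definition with body +
theorems; no named fact, net debt 0): third file of the discharge of the tree's named fact
`PAdicZetaValues.laiLupuSprang2025_theorem11`; it identifies the printed constant `ϖ_p` with the tree's
`PAdicZetaValues.llsVarpi p` of `Records.lean`.

## Source, as printed ([LaiLupuSprang2025, §7])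

* **Lemma 7.2.** «The limiting relation `lim_{n→∞} (1/n) Σ_{√(Cn) < q ≤ n, {n/q} ∈ [u,v)} log q = ψ(v) − ψ(u) + 1/v − 1/u`
  holds for any constant `C ≥ 0` and any interval `[u,v) ⊂ (0,1)`.  Here `q` runs only along primes and `{n/q}` is the
  fractional part of `n/q`.»
* **Lemma 7.3.** «We have `Φ_n = e^{ϖ_p n + o(n)}` as `n → ∞`, where
  `ϖ_p = ψ(1/p) + 2p − 1 + γ + p(log p − Σ_{j=1}^{p} 1/j)`.»  *Proof.* «By (def:Phi_n), we have
  `Φ_n = ∏_{√(pn) < q ≤ n} q^{φ(n/q)}` … Then Lemma 7.2 implies that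
  `lim (log Φ_n)/n = Σ_{j=2}^{p−1} (j−1)(ψ((j+1)/p) − ψ(j/p) + p/(j+1) − p/j) = (p−2)ψ(1) + p − 2 − Σ_{j=2}^{p−1}ψ(j/p) −
  pΣ_{j=2}^{p−1} 1/j = ψ(1/p) + (p−1)ψ(1) + 2p − 1 − Σ_{j=1}^{p}ψ(j/p) − pΣ_{j=1}^{p} 1/j`.  Using the following well-known
  identities (they follow easily from (def_digamma)) `ψ(1) = −γ`, `Σ_{j=1}^{p} ψ(j/p) = −p(γ + log p)`, we obtain
  `lim (log Φ_n)/n = … = ϖ_p`.»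
* **Lemma 7.4.** «We have `(p−1)(1−γ) − log 2 − 1 < ϖ_p < (p−1)(1−γ)`.»  (Proof from [EGP2000]'s bounds
  `log(x+½) − 1/x < ψ(x) < log(x + e^{−γ}) − 1/x` and `log p − Σ_{j=1}^{p} 1/j < −γ < log p − Σ_{j=1}^{p−1} 1/j`.)
* §8: «Take `s = ⌊(p−1−ϖ_p)/((p/(p−1))log p − 1 − log 2)⌋ + 1` … By Lemma 7.4 and `p ≥ 5` we know that this `s` is
  positive.»

## What is formalised (all PROVED; `p ≥ 2` unless stated)

* **Gauss's digamma sum** `sum_digamma_div`: `Σ_{i<p} ψ((i+1)/p) = −p(γ + log p)` (from the tree's Gauss limit formula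
  `Complex.tendsto_log_sub_sum_inv_digamma`, `ψ(w) = lim (log n − Σ_{k≤n} 1/(w+k))`, summed over `w = j/p`: the double
  sum is `p·H_{p(n+1)}`, and `H_{p(n+1)} − log n → γ + log p`), and the printed evaluation of the rate
  `sum_fracRate_eq_llsVarpi`: `Σ_{j=2}^{p−1} (ψ(2) − ψ(1 + j/p)) = ϖ_p` (`= llsVarpi p`).
* `stepL p n := Hata1992.stepFactor` of the windows `[j/p, 1)`, `j = 2,…,p−1`, weight `1`, `k₀ = 1` — the product
  `∏_{q ≤ n} q^{φ(n/q)}` WITHOUT the cut-off `q > √(pn)`; `stepFun_eq_phiExp` (its exponent at `{n/q}` is `φ(n/q)`),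
  `PhiL_dvd_stepL` and `stepL_dvd` (`stepL ∣ Φ_n · (∏_{q ≤ √(pn)} q)^{p−2}`), hence
  `log Φ_n ≤ log stepL ≤ log Φ_n + (p−2)θ(√(pn))` (`log_PhiL_le_log_stepL`, `log_stepL_le`) — the printed
  "`Σ_{√(Cn)<q≤n}` versus all `q`" bookkeeping of Lemma 7.2, with Chebyshev's `θ(x) ≤ x log 4` for the small primes.
* **Lemma 7.3** `tendsto_log_PhiL_div`: `log Φ_n / n → ϖ_p` (the window engine `Hata1992.tendsto_log_stepFactor_div` = the
  tree's form of Lemma 7.2, prime number theorem window by window), with the `ε`-forms `eventually_exp_le_PhiL`,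
  `eventually_PhiL_le_exp`.
* From Lemma 7.4, exactly what §8 uses: `re_digamma_inv_add_euler_lt` (`ψ(1/p) + γ < 1 − p`, the series (def_digamma)
  termwise), `llsVarpi_lt` (**`ϖ_p < p − 1`**, with `log p ≤ Σ_{j<p} 1/j`), and `llsDenom_pos`
  (`(p/(p−1))log p − 1 − log 2 > 0` for `p ≥ 5`), so that the printed `s` is a positive integer.
  DEVIATION (flagged): the two-sided numerical bounds of Lemma 7.4 via [EGP2000] are not needed for Theorem 1.1 and are
  not formalised; `ϖ_p < p − 1` is proved from the defining series instead.

Cell zeta5-irr / pub-zeta5 (HONEST FRAMING: systematic search; no irrationality claim unless kernel-certified): an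
auxiliary prime-number-theorem estimate of a PUBLISHED proof; nothing here bears on `ζ(5) ∈ ℝ`.
-/

noncomputable section

open Finset Filter Topology
open Literature.NumberTheory.Irrationality.Hata1992
open Literature.NumberTheory.Irrationality.PAdicZetaValues (llsVarpi)

namespace Literature.NumberTheory.Irrationality.LaiLupuSprang2025

/-! ## §1. Gauss's digamma sum `Σ_{j=1}^{p} ψ(j/p) = −p(γ + log p)` -/

/-- The double sum of the Gauss limit formula over `w = (i+1)/p`, `i < p`:
`Σ_{i<p} Σ_{k≤n} 1/((i+1)/p + k) = p·Σ_{m < p(n+1)} 1/(m+1)` (`(i,k) ↦ m = pk + i`).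
[cite: LaiLupuSprang2025, Lemma 7.3 (proof: "they follow easily from (def_digamma)")] -/
theorem sum_sum_one_div_eq {p : ℕ} (hp : 0 < p) (n : ℕ) :
    ∑ i ∈ range p, ∑ k ∈ range (n + 1), (1 : ℂ) / (((i + 1 : ℕ) : ℂ) / p + k) =
      (p : ℂ) * ∑ m ∈ range (p * (n + 1)), 1 / ((m : ℂ) + 1) := by
  have hp0 : (p : ℂ) ≠ 0 := by exact_mod_cast hp.ne'
  have hterm : ∀ i k : ℕ, (1 : ℂ) / (((i + 1 : ℕ) : ℂ) / p + k) = p * (1 / (((p * k + i : ℕ) : ℂ) + 1)) := by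
    intro i k
    have h1 : (((p * k + i : ℕ) : ℂ) + 1) ≠ 0 := by
      have : (0 : ℝ) < ((p * k + i : ℕ) : ℝ) + 1 := by positivity
      exact_mod_cast this.ne'
    have e : (((i + 1 : ℕ) : ℂ) / p + k) = ((((p * k + i : ℕ) : ℂ) + 1)) / p := by
      field_simp
      push_cast
      ring
    rw [e, one_div_div, ← mul_one_div]
  induction n with
  | zero =>
    rw [zero_add, mul_one, mul_sum]
    refine sum_congr rfl fun i _ => ?_
    rw [sum_range_one, hterm i 0, mul_zero, zero_add]
  | succ n ih =>
    have hsplit : ∀ i ∈ range p, ∑ k ∈ range (n + 1 + 1), (1 : ℂ) / (((i + 1 : ℕ) : ℂ) / p + k) =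
        ∑ k ∈ range (n + 1), (1 : ℂ) / (((i + 1 : ℕ) : ℂ) / p + k) + 1 / (((i + 1 : ℕ) : ℂ) / p + ((n + 1 : ℕ) : ℂ)) := by
      intro i _; rw [sum_range_succ]
    rw [sum_congr rfl hsplit, sum_add_distrib, ih, show p * (n + 1 + 1) = p * (n + 1) + p by ring,
      sum_range_add, mul_add (p : ℂ), mul_sum (s := range p)]
    congr 1
    refine sum_congr rfl fun i _ => ?_
    rw [hterm i (n + 1)]

/-- `Σ_{m<M} 1/(m+1) = H_M` in `ℂ`. [cite: LaiLupuSprang2025, Lemma 7.3 (proof)] -/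
theorem sum_one_div_eq_harmonic (M : ℕ) :
    ∑ m ∈ range M, (1 : ℂ) / ((m : ℂ) + 1) = ((harmonic M : ℝ) : ℂ) := by
  induction M with
  | zero => simp
  | succ M ih =>
    rw [sum_range_succ, ih, harmonic_succ]
    push_cast
    ring

/-- `H_{p(n+1)} − log n → γ + log p` (`H_m − log m → γ`, `log(p(n+1)) − log n → log p`).
[cite: LaiLupuSprang2025, Lemma 7.3 (proof: "they follow easily from (def_digamma)")] -/
theorem tendsto_harmonic_mul_sub_log {p : ℕ} (hp : 0 < p) :
    Tendsto (fun n : ℕ => (harmonic (p * (n + 1)) : ℝ) - Real.log n) atTop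
      (𝓝 (Real.eulerMascheroniConstant + Real.log p)) := by
  have hmap : Tendsto (fun n : ℕ => p * (n + 1)) atTop atTop := by
    refine tendsto_atTop_atTop.2 fun b => ⟨b, fun n hn => ?_⟩
    nlinarith
  have h1 : Tendsto (fun n : ℕ => (harmonic (p * (n + 1)) : ℝ) - Real.log ((p * (n + 1) : ℕ) : ℝ)) atTop
      (𝓝 Real.eulerMascheroniConstant) := Real.tendsto_harmonic_sub_log.comp hmap
  have h2 : Tendsto (fun n : ℕ => Real.log ((n : ℝ) + 1) - Real.log n) atTop (𝓝 0) :=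
    Real.tendsto_log_nat_add_one_sub_log
  have h := (h1.add h2).add (tendsto_const_nhds (x := Real.log p))
  rw [add_zero] at h
  refine h.congr' (Eventually.of_forall fun n => ?_)
  have hp' : (p : ℝ) ≠ 0 := by exact_mod_cast hp.ne'
  have hn' : (n : ℝ) + 1 ≠ 0 := by positivity
  simp only [Nat.cast_mul, Nat.cast_add, Nat.cast_one]
  rw [Real.log_mul hp' hn']
  ring

/-- **Gauss's digamma sum: `Σ_{i<p} ψ((i+1)/p) = −p(γ + log p)`** («well-known … follows easily from (def_digamma)»),
from the Gauss limit formula `ψ(w) = lim_n (log n − Σ_{k≤n} 1/(w+k))` of the tree summed over `w = (i+1)/p`.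
[cite: LaiLupuSprang2025, Lemma 7.3 (proof, "Σ_{j=1}^{p} ψ(j/p) = −p(γ + log p)")] -/
theorem sum_digamma_div {p : ℕ} (hp : 0 < p) :
    ∑ i ∈ range p, Complex.digamma (((i + 1 : ℕ) : ℂ) / p) =
      -(p : ℂ) * (Real.eulerMascheroniConstant + Real.log p : ℝ) := by
  have hlim : ∀ i ∈ range p, Tendsto (fun n : ℕ => (Real.log n : ℂ) -
      ∑ k ∈ range (n + 1), 1 / ((((i + 1 : ℕ) : ℂ) / p) + k)) atTop (𝓝 (Complex.digamma (((i + 1 : ℕ) : ℂ) / p))) := by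
    intro i _
    refine Literature.Analysis.SpecialFunctions.Complex.tendsto_log_sub_sum_inv_digamma ?_
    have : (((i + 1 : ℕ) : ℂ) / p) = ((((i + 1 : ℕ) : ℝ) / p : ℝ) : ℂ) := by push_cast; ring
    rw [this, Complex.ofReal_re]
    have : (0 : ℝ) < p := by exact_mod_cast hp
    positivity
  have hsum := tendsto_finsetSum (range p) hlim
  have hform : ∀ n : ℕ, ∑ i ∈ range p, ((Real.log n : ℂ) - ∑ k ∈ range (n + 1), 1 / ((((i + 1 : ℕ) : ℂ) / p) + k)) =
      -(p : ℂ) * (((harmonic (p * (n + 1)) : ℝ) - Real.log n : ℝ) : ℂ) := by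
    intro n
    rw [sum_sub_distrib, sum_sum_one_div_eq hp, sum_one_div_eq_harmonic, sum_const, card_range]
    push_cast
    ring
  simp_rw [hform] at hsum
  have h2 : Tendsto (fun n : ℕ => -(p : ℂ) * (((harmonic (p * (n + 1)) : ℝ) - Real.log n : ℝ) : ℂ)) atTop
      (𝓝 (-(p : ℂ) * ((Real.eulerMascheroniConstant + Real.log p : ℝ) : ℂ))) :=
    ((Complex.continuous_ofReal.tendsto _).comp (tendsto_harmonic_mul_sub_log hp)).const_mul _
  exact tendsto_nhds_unique hsum h2

/-- Real-part form: `Σ_{i<p} Re ψ((i+1)/p) = −p(γ + log p)`. [cite: LaiLupuSprang2025, Lemma 7.3 (proof)] -/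
theorem sum_re_digamma_div {p : ℕ} (hp : 0 < p) :
    ∑ i ∈ range p, (Complex.digamma (((i + 1 : ℕ) : ℂ) / p)).re =
      -(p : ℝ) * (Real.eulerMascheroniConstant + Real.log p) := by
  have h := congrArg Complex.re (sum_digamma_div hp)
  rw [Complex.re_sum] at h
  rw [h, ← Complex.ofReal_natCast, ← Complex.ofReal_neg, ← Complex.ofReal_mul, Complex.ofReal_re]

/-- `ψ(1 + j/p) = ψ(j/p) + p/j` for `1 ≤ j`. [cite: LaiLupuSprang2025, Lemma 7.3 (proof, first "=" : ψ(x+1) = ψ(x) + 1/x)] -/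
theorem digamma_div_add_one {p j : ℕ} (hp : 0 < p) (hj : 1 ≤ j) :
    Complex.digamma (((j : ℂ) / p) + 1) = Complex.digamma ((j : ℂ) / p) + (p : ℂ) / j := by
  have hne : ∀ m : ℕ, ((j : ℂ) / p) ≠ -(m : ℂ) := by
    intro m h
    have h' := congrArg Complex.re h
    have e : ((j : ℂ) / p) = (((j : ℝ) / p : ℝ) : ℂ) := by push_cast; ring
    rw [e, Complex.ofReal_re] at h'
    simp at h'
    have : (0 : ℝ) < (j : ℝ) / p := by
      have : (0 : ℝ) < p := by exact_mod_cast hp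
      have : (0 : ℝ) < j := by exact_mod_cast hj
      positivity
    linarith [(Nat.cast_nonneg m : (0 : ℝ) ≤ m)]
  rw [Complex.digamma_apply_add_one _ hne]
  have hp0 : (p : ℂ) ≠ 0 := by exact_mod_cast hp.ne'
  have hj0 : (j : ℂ) ≠ 0 := by exact_mod_cast (show j ≠ 0 by omega)
  rw [inv_div]

/-- `H_p = Σ_{j=1}^{p} 1/j` over `Ico 1 (p+1)` in `ℝ`. [cite: LaiLupuSprang2025, Lemma 7.3 ("Σ_{j=1}^{p} 1/j")] -/
theorem harmonic_eq_sum_Ico_one_div (p : ℕ) : (harmonic p : ℝ) = ∑ j ∈ Ico 1 (p + 1), (1 : ℝ) / j := by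
  induction p with
  | zero => simp
  | succ q ih =>
    rw [harmonic_succ, sum_Ico_succ_top (by omega : 1 ≤ q + 1)]
    push_cast
    rw [ih]
    ring

/-- **The printed evaluation of the rate**: `Σ_{j=2}^{p−1} (ψ(2) − ψ(1 + j/p)) = ϖ_p`, i.e.
`(p−2)ψ(1)+p−2−Σ_{j=2}^{p−1}ψ(j/p)−pΣ_{j=2}^{p−1}1/j = ψ(1/p)+2p−1+γ+p(log p−Σ_{j=1}^{p}1/j)` with Gauss's sum; here
with the tree's `Hata1992.fracRate (j/p) 1 1 = Re(ψ(1+1) − ψ(1+j/p))` and `PAdicZetaValues.llsVarpi p = ϖ_p`.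
[cite: LaiLupuSprang2025, Lemma 7.3 (proof, displayed chain of equalities)] -/
theorem sum_fracRate_eq_llsVarpi {p : ℕ} (hp : 2 ≤ p) :
    ∑ j ∈ Ico 2 p, fracRate ((j : ℝ) / p) 1 1 = llsVarpi p := by
  have hp0 : 0 < p := by omega
  have hpR : (0 : ℝ) < p := by exact_mod_cast hp0
  -- `ψ(2) = 1 − γ` (`ψ(1) = −γ`, `ψ(x+1) = ψ(x) + 1/x`; also the tree's `LFunctions.RealZeros.digamma_two`, not imported here)
  have digamma_two : Complex.digamma 2 = 1 - Real.eulerMascheroniConstant := by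
    have hne1 : ∀ m : ℕ, (1 : ℂ) ≠ -(m : ℂ) := by
      intro m h
      have h' := congrArg Complex.re h
      simp at h'
      linarith [(Nat.cast_nonneg m : (0 : ℝ) ≤ m)]
    rw [show (2 : ℂ) = 1 + 1 by norm_num, Complex.digamma_apply_add_one 1 hne1, Complex.digamma_one]
    simp; ring
  -- each window rate in digamma terms
  have hj : ∀ j ∈ Ico 2 p, fracRate ((j : ℝ) / p) 1 1 =
      (1 - Real.eulerMascheroniConstant) - (Complex.digamma ((j : ℂ) / p)).re - (p : ℝ) / j := by
    intro j hj
    have hj2 : 2 ≤ j := (mem_Ico.1 hj).1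
    have hj0 : (0 : ℝ) < j := by exact_mod_cast (show 0 < j by omega)
    have hjp : (0 : ℝ) < (j : ℝ) / p := by positivity
    rw [fracRate_eq_digamma hjp one_pos 1]
    have e1 : ((((1 : ℕ) : ℝ) + 1 : ℝ) : ℂ) = 2 := by push_cast; norm_num
    have e2 : ((((1 : ℕ) : ℝ) + (j : ℝ) / p : ℝ) : ℂ) = (j : ℂ) / p + 1 := by push_cast; ring
    rw [e1, e2, digamma_two, digamma_div_add_one hp0 (by omega)]
    have e3 : ((p : ℂ) / j) = (((p : ℝ) / j : ℝ) : ℂ) := by push_cast; ring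
    rw [e3]
    simp only [Complex.sub_re, Complex.add_re, Complex.one_re, Complex.ofReal_re]
    ring
  rw [sum_congr rfl hj, sum_sub_distrib, sum_sub_distrib, sum_const, Nat.card_Ico]
  -- the digamma sum over `j = 2..p-1` from Gauss's sum over `j = 1..p`
  have hrange : ∑ i ∈ range p, (Complex.digamma (((i + 1 : ℕ) : ℂ) / p)).re =
      ∑ j ∈ Ico 1 (p + 1), (Complex.digamma ((j : ℂ) / p)).re := by
    rw [sum_Ico_eq_sum_range, show p + 1 - 1 = p from rfl]
    refine sum_congr rfl fun i _ => ?_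
    rw [add_comm 1 i]
  have hsplit : ∑ j ∈ Ico 1 (p + 1), (Complex.digamma ((j : ℂ) / p)).re =
      (Complex.digamma ((1 : ℕ) / p : ℂ)).re + ∑ j ∈ Ico 2 p, (Complex.digamma ((j : ℂ) / p)).re +
        (Complex.digamma ((p : ℕ) / p : ℂ)).re := by
    rw [sum_Ico_succ_top (by omega : 1 ≤ p), sum_eq_sum_Ico_succ_bot (by omega : 1 < p)]
  have hGauss := sum_re_digamma_div hp0
  rw [hrange, hsplit] at hGauss
  have hpp : (Complex.digamma ((p : ℕ) / p : ℂ)).re = -Real.eulerMascheroniConstant := by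
    rw [div_self (by exact_mod_cast hp0.ne' : ((p : ℕ) : ℂ) ≠ 0), Complex.digamma_one]
    simp
  have h1p : (Complex.digamma ((1 : ℕ) / p : ℂ)).re = (Complex.digamma ((p : ℂ)⁻¹)).re := by
    rw [Nat.cast_one, one_div]
  -- the harmonic sum over `j = 2..p-1`
  have hharm : ∑ j ∈ Ico 2 p, (p : ℝ) / j = p * (harmonic p : ℝ) - p - 1 := by
    rw [harmonic_eq_sum_Ico_one_div p, sum_Ico_succ_top (by omega : 1 ≤ p), sum_eq_sum_Ico_succ_bot (by omega : 1 < p), mul_add, mul_add,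
      mul_sum]
    have : ∑ j ∈ Ico 2 p, (p : ℝ) * (1 / (j : ℝ)) = ∑ j ∈ Ico 2 p, (p : ℝ) / j :=
      sum_congr rfl fun j _ => by ring
    rw [this]
    field_simp
    ring
  rw [hharm]
  unfold llsVarpi
  have hcard : ((p - 2 : ℕ) : ℝ) = (p : ℝ) - 2 := by rw [Nat.cast_sub hp]; norm_num
  rw [nsmul_eq_mul, hcard]
  linarith [hGauss, hpp, h1p]

/-! ## §2. `Φ_n` versus the step factor of the windows `[j/p, 1)`, `j = 2, …, p−1` -/

/-- The step factor `∏_{q ≤ n} q^{φ(n/q)}` of the `1`-periodic step function `φ = Σ_{j=2}^{p−1} 𝟙_{[j/p,1)}` of (5.5)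
(`φ(x) = j − 1` on `[j/p,(j+1)/p)`), all primes `q` with `⌊n/q⌋ ≥ 1`, on the tree's window engine
`Hata1992.stepFactor`; it differs from `Φ_n` only by the cut-off `q > √(pn)`. [cite: LaiLupuSprang2025, Lemma 5.4 (5.4)–(5.5) and Lemma 7.3 (proof)] -/
def stepL (p n : ℕ) : ℕ :=
  stepFactor (Ico 2 p) (fun j : ℕ => (j : ℝ) / p) (fun _ => (1 : ℝ)) (fun _ => 1) 1 n

/-- The windows `[j/p, 1)` satisfy the engine's hypothesis `0 < u < v ≤ 1`. [cite: LaiLupuSprang2025, Lemma 5.4 (5.5)] -/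
theorem stepL_windows (p : ℕ) :
    ∀ j ∈ Ico 2 p, (0 : ℝ) < (fun j : ℕ => (j : ℝ) / p) j ∧
      (fun j : ℕ => (j : ℝ) / p) j < (fun _ : ℕ => (1 : ℝ)) j ∧ (fun _ : ℕ => (1 : ℝ)) j ≤ 1 := by
  intro j hj
  obtain ⟨hj2, hjp⟩ := mem_Ico.1 hj
  have hp : (0 : ℝ) < p := by exact_mod_cast (show 0 < p by omega)
  have hj' : (0 : ℝ) < j := by exact_mod_cast (show 0 < j by omega)
  refine ⟨by positivity, ?_, le_rfl⟩
  rw [div_lt_one hp]; exact_mod_cast hjp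

/-- `stepL p n > 0`. [cite: LaiLupuSprang2025, Lemma 7.3] -/
theorem stepL_pos (p n : ℕ) : 0 < stepL p n := stepFactor_pos _ _ _ _ _ _

/-- **The exponent of the step function at `{n/q} = (n mod q)/q` is `φ(n/q)`**:
`#{j ∈ [2,p−1] : j/p ≤ (n mod q)/q} = ⌊p(n mod q)/q⌋ ∸ 1 = phiExp p n q`. [cite: LaiLupuSprang2025, Lemma 5.4 (5.5)] -/
theorem stepFun_eq_phiExp {p q : ℕ} (hp : 0 < p) (hq : 0 < q) (n : ℕ) :
    stepFun (Ico 2 p) (fun j : ℕ => (j : ℝ) / p) (fun _ => (1 : ℝ)) (fun _ => 1) (((n % q : ℕ) : ℝ) / q) =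
      phiExp p n q := by
  classical
  have hpR : (0 : ℝ) < p := by exact_mod_cast hp
  have hqR : (0 : ℝ) < q := by exact_mod_cast hq
  have hlt1 : ((n % q : ℕ) : ℝ) / q < 1 := by
    rw [div_lt_one hqR]; exact_mod_cast Nat.mod_lt n hq
  unfold stepFun phiExp
  set J : ℕ := p * (n % q) / q with hJ
  have hJp : J + 1 ≤ p := by
    have : J < p := by
      rw [hJ, Nat.div_lt_iff_lt_mul hq]
      exact Nat.mul_lt_mul_of_pos_left (Nat.mod_lt n hq) hp
    omega
  have hiff : ∀ j : ℕ, ((j : ℝ) / p ≤ ((n % q : ℕ) : ℝ) / q) ↔ j ≤ J := by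
    intro j
    rw [div_le_div_iff₀ hpR hqR, hJ, Nat.le_div_iff_mul_le hq, mul_comm p (n % q)]
    constructor
    · intro h; exact_mod_cast h
    · intro h; exact_mod_cast h
  have hsum : (∑ j ∈ Ico 2 p, if (j : ℝ) / p ≤ ((n % q : ℕ) : ℝ) / q ∧ ((n % q : ℕ) : ℝ) / q < 1 then 1 else 0) =
      ((Ico 2 p).filter fun j => j ≤ J).card := by
    rw [card_filter]
    refine sum_congr rfl fun j _ => ?_
    simp only [hlt1, and_true, hiff]
  rw [hsum]
  have hfilter : ((Ico 2 p).filter fun j => j ≤ J) = Ico 2 (J + 1) := by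
    ext j
    simp only [mem_filter, mem_Ico]
    omega
  rw [hfilter, Nat.card_Ico]
  omega

/-- The `q`-adic valuation of the step factor: `φ(n/q)` if `q ≤ n`, else `0` (prime `q`).
[cite: LaiLupuSprang2025, Lemma 5.4 (5.4) and Lemma 7.3 (proof: "Φ_n = ∏_{√(pn)<q≤n} q^{φ(n/q)}")] -/
theorem padicValNat_stepL {p q : ℕ} (hp : 0 < p) (hq : q.Prime) (n : ℕ) :
    padicValNat q (stepL p n) = if q ≤ n then phiExp p n q else 0 := by
  unfold stepL
  rw [padicValNat_stepFactor (stepL_windows p) hq, Nat.floor_div_eq_div, Int.fract_div_natCast_eq_div_natCast_mod,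
    stepFun_eq_phiExp hp hq.pos]
  by_cases h : q ≤ n
  · rw [if_pos h, if_pos (show 1 ≤ n / q from Nat.div_pos h hq.pos)]
  · rw [if_neg h, if_neg (by rw [Nat.div_eq_of_lt (by omega)]; omega)]

/-- `φ(n/q) ≤ p − 2`. [cite: LaiLupuSprang2025, Lemma 5.4 (5.5) ("j − 1", j ≤ p − 1)] -/
theorem phiExp_le {p q : ℕ} (hp : 0 < p) (hq : 0 < q) (n : ℕ) : phiExp p n q ≤ p - 2 := by
  unfold phiExp
  have : p * (n % q) / q < p := by
    rw [Nat.div_lt_iff_lt_mul hq]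
    exact Nat.mul_lt_mul_of_pos_left (Nat.mod_lt n hq) hp
  omega

/-- **`Φ_n ∣ stepL`** (every prime of `Φ_n` has `q ≤ n` and the same exponent). [cite: LaiLupuSprang2025, Lemma 7.3 (proof)] -/
theorem PhiL_dvd_stepL {p : ℕ} (hp : 0 < p) (n : ℕ) : PhiL p n ∣ stepL p n := by
  rw [← Nat.factorization_le_iff_dvd (PhiL_pos p n).ne' (stepL_pos p n).ne']
  intro q
  by_cases hq : q.Prime
  · haveI : Fact q.Prime := ⟨hq⟩
    rw [Nat.factorization_def _ hq, Nat.factorization_def _ hq, padicValNat_stepL hp hq]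
    by_cases hmem : q ∈ phiPrimes p n
    · rw [padicValNat_PhiL_of_mem hmem, if_pos (mem_phiPrimes.1 hmem).1]
    · rw [padicValNat_PhiL_of_not_mem hmem]; exact Nat.zero_le _
  · simp [Nat.factorization_eq_zero_of_not_prime _ hq]

/-- **`stepL ∣ Φ_n · (∏_{q ≤ √(pn)} q)^{p−2}`**: a prime `q ≤ n` not in `Φ_n` has `q² ≤ pn`, and `φ(n/q) ≤ p − 2`.
[cite: LaiLupuSprang2025, Lemma 7.3 (proof) with Lemma 7.2 ("for any constant C ≥ 0": the cut-off √(Cn) is immaterial)] -/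
theorem stepL_dvd {p : ℕ} (hp : 2 ≤ p) (n : ℕ) :
    stepL p n ∣ PhiL p n * primorial (Nat.sqrt (p * n)) ^ (p - 2) := by
  have hp0 : 0 < p := by omega
  have hm : PhiL p n * primorial (Nat.sqrt (p * n)) ^ (p - 2) ≠ 0 :=
    mul_ne_zero (PhiL_pos p n).ne' (pow_ne_zero _ (primorial_pos _).ne')
  unfold stepL
  refine stepFactor_dvd_of_le_padicValNat (stepL_windows p) hm fun q hq hk => ?_
  haveI : Fact q.Prime := ⟨hq⟩
  rw [Nat.floor_div_eq_div] at hk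
  have hqn : q ≤ n := by
    by_contra h
    rw [Nat.div_eq_of_lt (by omega)] at hk
    omega
  rw [Int.fract_div_natCast_eq_div_natCast_mod, stepFun_eq_phiExp hp0 hq.pos,
    padicValNat.mul (PhiL_pos p n).ne' (pow_ne_zero _ (primorial_pos _).ne'), padicValNat.pow]
  by_cases hmem : q ∈ phiPrimes p n
  · rw [padicValNat_PhiL_of_mem hmem]; exact Nat.le_add_right _ _
  · have hsq : q * q ≤ p * n := by
      rw [mem_phiPrimes] at hmem
      by_contra hlt
      exact hmem ⟨hqn, hq, by omega⟩
    have hdvd : q ∣ primorial (Nat.sqrt (p * n)) := hq.dvd_primorial_iff.2 (Nat.le_sqrt.2 hsq)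
    have h1 : 1 ≤ padicValNat q (primorial (Nat.sqrt (p * n))) :=
      one_le_padicValNat_of_dvd (primorial_pos _).ne' hdvd
    calc phiExp p n q ≤ p - 2 := phiExp_le hp0 hq.pos n
      _ ≤ (p - 2) * padicValNat q (primorial (Nat.sqrt (p * n))) := by
          simpa using Nat.mul_le_mul_left (p - 2) h1
      _ ≤ padicValNat q (PhiL p n) + (p - 2) * padicValNat q (primorial (Nat.sqrt (p * n))) := Nat.le_add_left _ _

/-- `log Φ_n ≤ log stepL`. [cite: LaiLupuSprang2025, Lemma 7.3 (proof)] -/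
theorem log_PhiL_le_log_stepL {p : ℕ} (hp : 0 < p) (n : ℕ) :
    Real.log (PhiL p n : ℝ) ≤ Real.log (stepL p n : ℝ) :=
  Real.log_le_log (by exact_mod_cast PhiL_pos p n) (by exact_mod_cast Nat.le_of_dvd (stepL_pos p n) (PhiL_dvd_stepL hp n))

/-- **`log stepL ≤ log Φ_n + (p−2)·θ(√(pn))`** (the printed `Σ_{√(pn)<q≤n}` versus the full window sum of Lemma 7.2).
[cite: LaiLupuSprang2025, Lemma 7.3 (proof) and Lemma 7.2] -/
theorem log_stepL_le {p : ℕ} (hp : 2 ≤ p) (n : ℕ) :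
    Real.log (stepL p n : ℝ) ≤ Real.log (PhiL p n : ℝ) + ((p : ℝ) - 2) * Chebyshev.theta (Real.sqrt ((p : ℝ) * n)) := by
  have hle : (stepL p n : ℝ) ≤ (PhiL p n : ℝ) * (primorial (Nat.sqrt (p * n)) : ℝ) ^ (p - 2) := by
    have := Nat.le_of_dvd (Nat.pos_of_ne_zero (mul_ne_zero (PhiL_pos p n).ne' (pow_ne_zero _ (primorial_pos _).ne')))
      (stepL_dvd hp n)
    exact_mod_cast this
  have hP : (0 : ℝ) < (primorial (Nat.sqrt (p * n)) : ℝ) := by exact_mod_cast primorial_pos _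
  have hθ : Real.log (primorial (Nat.sqrt (p * n)) : ℝ) = Chebyshev.theta (Nat.sqrt (p * n) : ℝ) := by
    rw [Chebyshev.theta_eq_log_primorial, Nat.floor_natCast]
  have hmono : Chebyshev.theta (Nat.sqrt (p * n) : ℝ) ≤ Chebyshev.theta (Real.sqrt ((p : ℝ) * n)) := by
    refine Chebyshev.theta_mono ?_
    rw [Real.le_sqrt (Nat.cast_nonneg _) (by positivity)]
    exact_mod_cast Nat.sqrt_le' (p * n)
  have hcast : ((p - 2 : ℕ) : ℝ) = (p : ℝ) - 2 := by rw [Nat.cast_sub hp]; norm_num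
  calc Real.log (stepL p n : ℝ)
      ≤ Real.log ((PhiL p n : ℝ) * (primorial (Nat.sqrt (p * n)) : ℝ) ^ (p - 2)) :=
        Real.log_le_log (by exact_mod_cast stepL_pos p n) hle
    _ = Real.log (PhiL p n : ℝ) + ((p - 2 : ℕ) : ℝ) * Chebyshev.theta (Nat.sqrt (p * n) : ℝ) := by
        rw [Real.log_mul (by exact_mod_cast (PhiL_pos p n).ne') (pow_ne_zero _ hP.ne'), Real.log_pow, hθ]
    _ ≤ Real.log (PhiL p n : ℝ) + ((p : ℝ) - 2) * Chebyshev.theta (Real.sqrt ((p : ℝ) * n)) := by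
        rw [hcast]
        have h2' : (2 : ℝ) ≤ p := by exact_mod_cast hp
        have h2 : (0 : ℝ) ≤ (p : ℝ) - 2 := by linarith
        nlinarith [mul_le_mul_of_nonneg_left hmono h2]

/-! ## §3. Lemma 7.3: `log Φ_n / n → ϖ_p` -/

/-- `θ(√(cn))/n → 0` for a constant `c ≥ 0` (Chebyshev `θ(x) ≤ x log 4`). [cite: LaiLupuSprang2025, Lemma 7.2 ("for any constant C ≥ 0")] -/
theorem tendsto_theta_sqrt_mul_div {c : ℝ} (hc : 0 ≤ c) :
    Tendsto (fun n : ℕ => Chebyshev.theta (Real.sqrt (c * n)) / n) atTop (𝓝 0) := by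
  have h1 : Tendsto (fun n : ℕ => Real.log 4 * Real.sqrt (c / (n : ℝ))) atTop (𝓝 0) := by
    have h := ((tendsto_const_div_atTop_nhds_zero_nat c).sqrt).const_mul (Real.log 4)
    simpa using h
  refine squeeze_zero' (Eventually.of_forall fun n =>
    div_nonneg (Chebyshev.theta_nonneg _) (Nat.cast_nonneg n)) ?_ h1
  filter_upwards [eventually_gt_atTop 0] with n hn
  have hn' : (0 : ℝ) < n := by exact_mod_cast hn
  rw [div_le_iff₀ hn']
  calc Chebyshev.theta (Real.sqrt (c * n)) ≤ Real.log 4 * Real.sqrt (c * n) :=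
        Chebyshev.theta_le_log4_mul_x (Real.sqrt_nonneg _)
    _ = Real.log 4 * Real.sqrt (c / (n : ℝ)) * n := by
        rw [mul_assoc]
        congr 1
        have h4 : Real.sqrt (n : ℝ) ^ 2 = n := Real.sq_sqrt hn'.le
        rw [Real.sqrt_div' c hn'.le, Real.sqrt_mul hc]
        field_simp
        rw [h4]

/-- `log stepL / n → ϖ_p` (the window engine, Lemma 7.2, window by window, and §1). [cite: LaiLupuSprang2025, Lemma 7.2 and Lemma 7.3 (proof)] -/
theorem tendsto_log_stepL_div {p : ℕ} (hp : 2 ≤ p) :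
    Tendsto (fun n : ℕ => Real.log (stepL p n : ℝ) / n) atTop (𝓝 (llsVarpi p)) := by
  have h := tendsto_log_stepFactor_div (c := fun _ : ℕ => 1) (stepL_windows p) 1
  simp only [Nat.cast_one, one_mul] at h
  rw [sum_fracRate_eq_llsVarpi hp] at h
  exact h

/-- **Lemma 7.3** (as printed): `log Φ_n / n → ϖ_p`, i.e. `Φ_n = e^{(ϖ_p + o(1))n}`. [cite: LaiLupuSprang2025, Lemma 7.3] -/
theorem tendsto_log_PhiL_div {p : ℕ} (hp : 2 ≤ p) :
    Tendsto (fun n : ℕ => Real.log (PhiL p n : ℝ) / n) atTop (𝓝 (llsVarpi p)) := by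
  have hp0 : 0 < p := by omega
  have hS := tendsto_log_stepL_div hp
  have hθ := (tendsto_theta_sqrt_mul_div (c := (p : ℝ)) (by positivity)).const_mul ((p : ℝ) - 2)
  rw [mul_zero] at hθ
  have hdiff : Tendsto (fun n : ℕ => (Real.log (stepL p n : ℝ) - Real.log (PhiL p n : ℝ)) / n) atTop (𝓝 0) := by
    refine squeeze_zero' (Eventually.of_forall fun n =>
      div_nonneg (sub_nonneg.2 (log_PhiL_le_log_stepL hp0 n)) (Nat.cast_nonneg n)) ?_ hθ
    refine Eventually.of_forall fun n => ?_
    rw [← mul_div_assoc]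
    exact div_le_div_of_nonneg_right (by have := log_stepL_le hp n; linarith) (Nat.cast_nonneg n)
  have h := hS.sub hdiff
  rw [sub_zero] at h
  refine h.congr fun n => ?_
  ring

/-- Lemma 7.3, lower `ε`-form: **`e^{(ϖ_p − ε)n} ≤ Φ_n`** for all large `n` (the form used in §8).
[cite: LaiLupuSprang2025, Lemma 7.3 and §8 ("by … Lemma 7.3 we have max_i|ρ̃_i| ≤ … e^{(p−1+s−ϖ_p)n+o(n)}")] -/
theorem eventually_exp_le_PhiL {p : ℕ} (hp : 2 ≤ p) {ε : ℝ} (hε : 0 < ε) :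
    ∀ᶠ n : ℕ in atTop, Real.exp ((llsVarpi p - ε) * n) ≤ (PhiL p n : ℝ) := by
  have h2 : ∀ᶠ n : ℕ in atTop, llsVarpi p - ε < Real.log (PhiL p n : ℝ) / n :=
    (tendsto_log_PhiL_div hp).eventually (eventually_gt_nhds (by linarith))
  filter_upwards [h2, eventually_gt_atTop 0] with n hn hn0
  have hn' : (0 : ℝ) < n := by exact_mod_cast hn0
  have hpos : (0 : ℝ) < (PhiL p n : ℝ) := by exact_mod_cast PhiL_pos p n
  rw [lt_div_iff₀ hn'] at hn
  calc Real.exp ((llsVarpi p - ε) * n) ≤ Real.exp (Real.log (PhiL p n : ℝ)) := Real.exp_le_exp.mpr hn.le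
    _ = (PhiL p n : ℝ) := Real.exp_log hpos

/-- Lemma 7.3, upper `ε`-form: `Φ_n ≤ e^{(ϖ_p + ε)n}` for all large `n`. [cite: LaiLupuSprang2025, Lemma 7.3] -/
theorem eventually_PhiL_le_exp {p : ℕ} (hp : 2 ≤ p) {ε : ℝ} (hε : 0 < ε) :
    ∀ᶠ n : ℕ in atTop, (PhiL p n : ℝ) ≤ Real.exp ((llsVarpi p + ε) * n) := by
  have h2 : ∀ᶠ n : ℕ in atTop, Real.log (PhiL p n : ℝ) / n < llsVarpi p + ε :=
    (tendsto_log_PhiL_div hp).eventually (eventually_lt_nhds (by linarith))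
  filter_upwards [h2, eventually_gt_atTop 0] with n hn hn0
  have hn' : (0 : ℝ) < n := by exact_mod_cast hn0
  have hpos : (0 : ℝ) < (PhiL p n : ℝ) := by exact_mod_cast PhiL_pos p n
  rw [div_lt_iff₀ hn'] at hn
  calc (PhiL p n : ℝ) = Real.exp (Real.log (PhiL p n : ℝ)) := (Real.exp_log hpos).symm
    _ ≤ Real.exp ((llsVarpi p + ε) * n) := Real.exp_le_exp.mpr hn.le

/-! ## §4. From Lemma 7.4: `ϖ_p < p − 1` and the positivity of the denominator of `c_p` -/

/-- `ψ(1/p) + γ < 1 − p` (`p ≥ 2`): in the series `ψ(x) + γ = Σ_{m≥0}(1/(m+1) − 1/(m+x))` of (def_digamma) at `x = 1/p`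
the term `m = 0` is `1 − p`, the term `m = 1` is `< 0` and all others are `≤ 0`. [cite: LaiLupuSprang2025, §7 (def_digamma) and Lemma 7.4] -/
theorem re_digamma_inv_add_euler_lt {p : ℕ} (hp : 2 ≤ p) :
    (Complex.digamma ((p : ℂ)⁻¹)).re + Real.eulerMascheroniConstant < 1 - p := by
  have hpR : (0 : ℝ) < p := by exact_mod_cast (show 0 < p by omega)
  have hre : (0 : ℝ) < ((p : ℂ)⁻¹).re := by
    rw [show ((p : ℂ)⁻¹) = (((p : ℝ)⁻¹ : ℝ) : ℂ) by push_cast; rfl, Complex.ofReal_re]; positivity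
  have h := Literature.Analysis.SpecialFunctions.Complex.hasSum_one_div_sub_one_div_digamma hre
  have hfun : ∀ k : ℕ, (1 : ℂ) / ((k : ℂ) + 1) - 1 / ((p : ℂ)⁻¹ + k) =
      ((1 / ((k : ℝ) + 1) - 1 / ((p : ℝ)⁻¹ + k) : ℝ) : ℂ) := by
    intro k; push_cast; ring
  simp_rw [hfun] at h
  have hreal : HasSum (fun k : ℕ => 1 / ((k : ℝ) + 1) - 1 / ((p : ℝ)⁻¹ + k))
      ((Complex.digamma ((p : ℂ)⁻¹)).re + Real.eulerMascheroniConstant) := by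
    have := Complex.hasSum_re h
    simpa only [Complex.ofReal_re, Complex.add_re, Complex.ofReal_re] using this
  -- split off the terms `k = 0` (`= 1 − p`) and `k = 1` (`< 0`); the others are `≤ 0`
  have htail := (hasSum_nat_add_iff' 2).2 hreal
  simp only [sum_range_succ, sum_range_zero, Nat.cast_zero, Nat.cast_one, zero_add, add_zero, div_one] at htail
  have hnonpos : ∀ k : ℕ, 1 / (((k + 2 : ℕ) : ℝ) + 1) - 1 / ((p : ℝ)⁻¹ + ((k + 2 : ℕ) : ℝ)) ≤ 0 := by
    intro k
    have hk : (0 : ℝ) < (p : ℝ)⁻¹ + ((k + 2 : ℕ) : ℝ) := by positivity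
    have hle : (p : ℝ)⁻¹ + ((k + 2 : ℕ) : ℝ) ≤ ((k + 2 : ℕ) : ℝ) + 1 := by
      have : (p : ℝ)⁻¹ ≤ 1 := inv_le_one_of_one_le₀ (by exact_mod_cast (show 1 ≤ p by omega))
      linarith
    have := one_div_le_one_div_of_le hk hle
    linarith
  have h0 := htail.nonpos hnonpos
  have hinv : (1 : ℝ) / (p : ℝ)⁻¹ = p := by rw [one_div, inv_inv]
  rw [hinv] at h0
  -- the term `k = 1`: `1/2 − 1/(1/p + 1) = (1 − p)/(2(p+1)) < 0`
  have h1 : (1 : ℝ) / (1 + 1) - 1 / ((p : ℝ)⁻¹ + 1) < 0 := by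
    have hp2 : (2 : ℝ) ≤ p := by exact_mod_cast hp
    have e : (1 : ℝ) / ((p : ℝ)⁻¹ + 1) = p / (1 + p) := by
      field_simp
    rw [e, sub_neg, div_lt_div_iff₀ (by norm_num) (by linarith)]
    linarith
  linarith

/-- `p(log p − H_p) ≤ −1`, from `log p ≤ Σ_{j<p} 1/j = H_{p−1}` (`p ≥ 1`).
[cite: LaiLupuSprang2025, Lemma 7.4 (proof: "log p − Σ_{j=1}^{p} 1/j < −γ < log p − Σ_{j=1}^{p−1} 1/j")] -/
theorem mul_log_sub_harmonic_le {p : ℕ} (hp : 1 ≤ p) :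
    (p : ℝ) * (Real.log p - (harmonic p : ℝ)) ≤ -1 := by
  obtain ⟨q, rfl⟩ : ∃ q, p = q + 1 := ⟨p - 1, by omega⟩
  have h1 : Real.log ((q + 1 : ℕ) : ℝ) ≤ (harmonic q : ℝ) := log_add_one_le_harmonic q
  have h2 : ((harmonic (q + 1) : ℚ) : ℝ) = (harmonic q : ℝ) + 1 / ((q + 1 : ℕ) : ℝ) := by
    rw [harmonic_succ]; push_cast; ring
  rw [h2]
  have hq : (0 : ℝ) < ((q + 1 : ℕ) : ℝ) := by positivity
  have : ((q + 1 : ℕ) : ℝ) * (Real.log ((q + 1 : ℕ) : ℝ) - (harmonic q : ℝ)) ≤ 0 :=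
    mul_nonpos_of_nonneg_of_nonpos hq.le (by linarith)
  have e : ((q + 1 : ℕ) : ℝ) * (1 / ((q + 1 : ℕ) : ℝ)) = 1 := by field_simp
  nlinarith

/-- **`ϖ_p < p − 1`** (`p ≥ 2`; the half of Lemma 7.4 used in §8: `s = ⌊(p−1−ϖ_p)/…⌋ + 1` is positive).
[cite: LaiLupuSprang2025, Lemma 7.4 ("ϖ_p < (p−1)(1−γ)") and §8] -/
theorem llsVarpi_lt {p : ℕ} (hp : 2 ≤ p) : llsVarpi p < p - 1 := by
  unfold llsVarpi
  have h1 := re_digamma_inv_add_euler_lt hp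
  have h2 := mul_log_sub_harmonic_le (show 1 ≤ p by omega)
  linarith

/-- `log 3 > 1` (`e < 3`). [folklore] -/
private theorem one_lt_log_three : 1 < Real.log 3 := by
  rw [Real.lt_log_iff_exp_lt (by norm_num)]
  exact lt_trans Real.exp_one_lt_d9 (by norm_num)

/-- **The denominator of `c_p` is positive**: `(p/(p−1))log p − 1 − log 2 > 0` for `p ≥ 5` (so that (sss) can be met and
`c_p = p + (p−1−ϖ_p)/((p/(p−1))log p − 1 − log 2) > p`). [cite: LaiLupuSprang2025, §8 (sss) and the choice of `s`)] -/
theorem llsDenom_pos {p : ℕ} (hp : 5 ≤ p) :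
    0 < (p : ℝ) / (p - 1) * Real.log p - 1 - Real.log 2 := by
  have hpR : (5 : ℝ) ≤ p := by exact_mod_cast hp
  have hlogp : 0 < Real.log p := Real.log_pos (by linarith)
  have hfrac : 1 ≤ (p : ℝ) / (p - 1) := by
    rw [le_div_iff₀ (by linarith)]; linarith
  have hge : Real.log p ≤ (p : ℝ) / (p - 1) * Real.log p := by nlinarith
  rcases (show p = 5 ∨ 6 ≤ p by omega) with rfl | h6
  · -- `5 log 5 > 4 + 4 log 2`: `3125 > 16 e^4`
    have h5 : ((5 : ℕ) : ℝ) / ((5 : ℕ) - 1) * Real.log (5 : ℕ) - 1 - Real.log 2 =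
        (5 * Real.log 5 - (4 + 4 * Real.log 2)) / 4 := by push_cast; ring
    rw [h5]
    refine div_pos (sub_pos.2 ?_) (by norm_num)
    rw [← Real.exp_lt_exp]
    have e1 : Real.exp (5 * Real.log 5) = 5 ^ 5 := by
      rw [show (5 : ℝ) * Real.log 5 = ((5 : ℕ) : ℝ) * Real.log 5 by norm_num, Real.exp_nat_mul,
        Real.exp_log (by norm_num)]
    have e2a : Real.exp (4 * Real.log 2) = 2 ^ 4 := by
      rw [show (4 : ℝ) * Real.log 2 = ((4 : ℕ) : ℝ) * Real.log 2 by norm_num, Real.exp_nat_mul,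
        Real.exp_log (by norm_num)]
    have e2b : Real.exp 4 = Real.exp 1 ^ 4 := by
      rw [← Real.exp_nat_mul]; norm_num
    rw [e1, Real.exp_add, e2a, e2b]
    have he : Real.exp 1 < 2.7182818286 := Real.exp_one_lt_d9
    have he0 : 0 < Real.exp 1 := Real.exp_pos 1
    have h4 : Real.exp 1 ^ 4 < 2.7182818286 ^ 4 := pow_lt_pow_left₀ he he0.le (by norm_num)
    nlinarith
  · have h6R : (6 : ℝ) ≤ p := by exact_mod_cast h6
    have hlog6 : Real.log 6 ≤ Real.log p := Real.log_le_log (by norm_num) h6R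
    have hsplit : Real.log 6 = Real.log 2 + Real.log 3 := by
      rw [show (6 : ℝ) = 2 * 3 by norm_num, Real.log_mul (by norm_num) (by norm_num)]
    linarith [one_lt_log_three]

end Literature.NumberTheory.Irrationality.LaiLupuSprang2025

end
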